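import Summits.ResolutionOfSingularities.ResolutionOfSingularities.Theorems.MarkedTransferCampaignW12SandwichK11ReproW3
import Mathlib.RingTheory.MvPolynomial.Ideal
import Mathlib.Data.Fin.VecNotation
import Mathlib.Tactic.FinCases
import Mathlib.Tactic.LinearCombination
import HarnessLib

/-!
# [OURS · L1 W1.2 · K1.2 blind reproduction, part 3] Box coefficients of `℘(E,2)` on the R01/R04/R08 witness
# `W1 = ((y² + xw²), 2) ⊂ 𝔸³` (`p = 2`, `ξ = 0`, `q = m = 2`, `e = 1`) from ONE blow-up chart over `Z[t]`; the no-unit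
# property of its sandwich negative modules (res-L1-k11, gen 2)

Part 3 of the INDEPENDENT («blind») re-derivation of res-L1-k12's registered kill test K1.2 (HOME/STATUS.md
2026-08-26T19:41:04Z); parts 1–2 = `MarkedTransferCampaignW12SandwichK11ReproW2.lean` (`W2`; multiples-only no-unit
lemma) and `…K11ReproW3.lean` (`W3`; generic lemmas on `𝔪_ξ^{[2]}`). Object = the typed `Campaign.sandwichPNega p e P m a`
(res-L1-type-o2, p461383). PROOFS ONLY — every polynomial is written out.

HOW `℘(E,·)` ENTERS (hypotheses on an abstract family `P : ℕ → Ideal O`, `P j` standing for `℘(E,j)`; each is an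
instance of the manuscript's GEOMETRIC DEFINITION of `℘` (p.17 l.1–2: «`℘(E,a)` … the union of those ideals `I` such
that `𝔖(I,a) ⊃ 𝔖(J,b)`», with `𝔖` = the LSBs over `Z[t]` permissible for `E[t]`, Def 2.4–2.5 p.6 l.1–12) — a
CANDIDATE [claim: Hironaka2017, status: under-review] consumed as a hypothesis, never asserted):
* (ORD) `P j ⊆ 𝔪_ξ^j` for all `j` (`ξ ∈ Sing(E)` is a permissible centre; `𝔪_ξ^j = idealOfVars^j`).
* (LSB) for `f ∈ P 2`: over `Z[t] = 𝔸³ × 𝔸¹_t`, blow up the smooth curve `D_t = {x = t², y = 0, w = 0} ⊂ Sing(E[t]) =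
  {y = w = 0}` (`W1_g_mem_centre_sq`: `g ∈ I(D_t)²`; in the coordinates `x' = x + t²`, `u = y + tw` one has
  `g = u² + x'w²` — the translation `(x,y,w) ↦ (x + γ², y + γw, w)` preserves `g` for every `γ`, and `γ = t` is the
  universal choice); `w`-chart `φ : x ↦ x₂w + t², y ↦ (u₂ + t)w, w ↦ w`, exceptional equation `w`, and the `t`-axis
  `C = {x₂ = u₂ = w = 0} ⊂ Sing(E[t]′)` (`W1_chart_g`: `g′ = u₂² + x₂w ∈ I(C)²`); the hypothesis is
  `φ f ∈ (w²)·I(C)²` («the transform of `((f),2)[t]` exists on the chart and has order `≥ 2` along `C`»). The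
  `Z[t]`-extension is part of `𝔖(E)` (Rem 2.6 p.6 l.17–19 «It is important to include those ambient extensions»); it
  replaces the family of translated centres `(γ², 0, 0)`, `γ ∈ 𝕂`, and works over `𝕂 = 𝔽₂`. (The two charts of the
  blow-up at `ξ` alone do not isolate the coefficient of `xyw`; the `t`-parity of the `Z[t]`-chart does:
  `W1_specMap_fiber`.)

WHAT IS PROVED (sorry-free; `O = 𝔽₂[x,y,w]`, `Fin 3`: `0 = x`, `1 = y`, `2 = w`; chart ring `𝔽₂[x₂,u₂,w,t]`, `Fin 4`:
`0 = x₂`, `1 = u₂`, `2 = w`, `3 = t`; `𝔪_ξ = idealOfVars`, `𝔪_ξ^{[2]} = (x², y², w²)`):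
* `W1_P2_le_span_sq`: (LSB) alone forces ALL EIGHT box coefficients (`xᵃyᵇwᶜ`, `a,b,c ≤ 1`, including `xyw`) of every
  `f ∈ P 2` to vanish — they are the coefficients of `wᵃtᵇ`, `a ≤ 2`, of `f(t², tw, w) ∈ (w⁴)` (`W1_coeff_transport`);
  so `P 2 ⊆ 𝔪_ξ^{[2]}`.
* `W1_sandwichNegaNoUnit`: with (ORD) for the degrees `2n ≥ 4` (`𝔪_ξ⁴ ⊆ 𝔪_ξ^{[2]}`), `sandwichPNega 2 1 P 2 a ⊆
  𝔪_ξ^{[2]} ⊆ 𝔪_ξ` for ALL `a`, hence `Campaign.SandwichNegaNoUnit 2 1 P 2` — the ALIVE-type certificate shape of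
  the K1.2 registration for `W1` (and verbatim for its `x`-chart transform `E′ = ((y₁² + xw₁²), 2)`, the same polynomial).
* `W1_hypotheses_nonvacuous`: the family `P j = if j = 2 then (g) else 0` satisfies (ORD)+(LSB).
* Appendix (`sandwichPNega_le_span_of_window`, `W2_sandwichPNega_le_of_three_le`): in degree `−a` only the multiples
  `℘(E, n·m)` with `n·m ≥ a` enter; hence for the part-1 witness `W2` the degrees `a ≥ 3` ARE in `𝔪_ξ` under (ORD), so
  `{a : ℘nega_sandwich(W2,−a) ⊄ 𝔪_ξ} = {1, 2}`.

HONEST FRAMING. Nothing here is a statement of H. Hironaka's manuscript *Resolution of singularities in positive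
characteristics* (2017-03-23, [Hironaka2017], lit key `paper:url-3343fd9e678b`), nothing asserts or denies any of its
statements, no verdict on K1.2 (res-L1-k12 scores it) or on GAP-LEDGER rows R01/R04/R08 is implied, and nothing here
is progress on resolution of singularities in positive characteristic. AI proof is weaker than expert review.
-/

noncomputable section

set_option linter.dupNamespace false -- mandated namespace of this single-conjunct summit

namespace Summit.ResolutionOfSingularities.ResolutionOfSingularities.Theorems.Campaign.K11Repro

open MvPolynomial
open Literature.AlgebraicGeometry.Resolution
open Literature.AlgebraicGeometry.Hironaka2017
open Summit.ResolutionOfSingularities.ResolutionOfSingularities.Theorems.Campaign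

/-! ## `W1 = ((y² + xw²), 2) ⊂ 𝔸³ = Spec 𝔽₂[x, y, w]` (`Fin 3`: `0 = x`, `1 = y`, `2 = w`); chart ring
`𝔽₂[x₂, u₂, w, t]` (`Fin 4`: `0 = x₂`, `1 = u₂`, `2 = w`, `3 = t`) -/

section W1

/-- `ξ ∈ Sing(E)`: `g = y² + xw² ∈ 𝔪_ξ²` (`ord_ξ g = 2 = m`). [folklore] -/
theorem W1_g_mem_sq :
    (X 1 ^ 2 + X 0 * X 2 ^ 2 : MvPolynomial (Fin 3) (ZMod 2)) ∈ idealOfVars (Fin 3) (ZMod 2) ^ 2 := by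
  have h0 : (X 0 : MvPolynomial (Fin 3) (ZMod 2)) ∈ idealOfVars (Fin 3) (ZMod 2) :=
    Ideal.subset_span (Set.mem_range_self 0)
  have h1 : (X 1 : MvPolynomial (Fin 3) (ZMod 2)) ∈ idealOfVars (Fin 3) (ZMod 2) :=
    Ideal.subset_span (Set.mem_range_self 1)
  have h2 : (X 2 : MvPolynomial (Fin 3) (ZMod 2)) ∈ idealOfVars (Fin 3) (ZMod 2) :=
    Ideal.subset_span (Set.mem_range_self 2)
  refine add_mem (Ideal.pow_mem_pow h1 2) ?_
  rw [show (X 0 * X 2 ^ 2 : MvPolynomial (Fin 3) (ZMod 2)) = (X 0 * X 2) * X 2 by ring, pow_two]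
  exact Ideal.mul_mem_right _ _ (Ideal.mul_mem_mul h0 h2)

/-- **The centre `D_t = {x = t², y = 0, w = 0} ⊂ Z[t] = 𝔸³ × 𝔸¹_t` lies in `Sing(E[t])`**: `g ∈ I(D_t)²` with
`I(D_t) = (x + t², y + tw, w)` — in characteristic `2`, `g = (y + tw)² + (x + t²)·w·w` (ring `𝔽₂[x, y, w, t]`, `Fin 4`:
`0 = x`, `1 = y`, `2 = w`, `3 = t`). `D_t` is the graph of `t ↦ (t², 0, 0)`, a smooth irreducible curve, hence an
`E[t]`-permissible centre (p.4 l.36–38). [folklore] -/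
theorem W1_g_mem_centre_sq :
    (X 1 ^ 2 + X 0 * X 2 ^ 2 : MvPolynomial (Fin 4) (ZMod 2)) ∈
      Ideal.span {(X 0 + X 3 ^ 2 : MvPolynomial (Fin 4) (ZMod 2)), X 1 + X 3 * X 2, X 2} ^ 2 := by
  have ha : (X 0 + X 3 ^ 2 : MvPolynomial (Fin 4) (ZMod 2)) ∈
      Ideal.span {(X 0 + X 3 ^ 2 : MvPolynomial (Fin 4) (ZMod 2)), X 1 + X 3 * X 2, X 2} :=
    Ideal.subset_span (by simp)
  have hb : (X 1 + X 3 * X 2 : MvPolynomial (Fin 4) (ZMod 2)) ∈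
      Ideal.span {(X 0 + X 3 ^ 2 : MvPolynomial (Fin 4) (ZMod 2)), X 1 + X 3 * X 2, X 2} :=
    Ideal.subset_span (by simp)
  have hc : (X 2 : MvPolynomial (Fin 4) (ZMod 2)) ∈
      Ideal.span {(X 0 + X 3 ^ 2 : MvPolynomial (Fin 4) (ZMod 2)), X 1 + X 3 * X 2, X 2} :=
    Ideal.subset_span (by simp)
  have h2 : (2 : MvPolynomial (Fin 4) (ZMod 2)) = 0 := CharTwo.two_eq_zero
  have key : (X 1 ^ 2 + X 0 * X 2 ^ 2 : MvPolynomial (Fin 4) (ZMod 2)) =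
      (X 1 + X 3 * X 2) * (X 1 + X 3 * X 2) + (X 0 + X 3 ^ 2) * (X 2 * X 2) := by
    linear_combination (-(X 1 * X 3 * X 2) - X 3 ^ 2 * X 2 ^ 2) * h2
  rw [key, pow_two]
  exact add_mem (Ideal.mul_mem_mul hb hb) (Ideal.mul_mem_mul ha (Ideal.mul_mem_left _ _ hc))

/-- **The `w`-chart of the blow-up of `Z[t]` along `D_t`**: `φ : x ↦ x₂w + t², y ↦ (u₂ + t)w, w ↦ w` (so `x + t² = x₂w`,
`y + tw = u₂w`; exceptional divisor `w = 0`); in characteristic `2`, `φ(g) = w²·g′` with strict transform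
`g′ = u₂² + x₂w`. [folklore] -/
theorem W1_chart_g :
    aeval ![(X 0 * X 2 + X 3 ^ 2 : MvPolynomial (Fin 4) (ZMod 2)), (X 1 + X 3) * X 2, X 2]
        (X 1 ^ 2 + X 0 * X 2 ^ 2 : MvPolynomial (Fin 3) (ZMod 2)) =
      X 2 ^ 2 * (X 1 ^ 2 + X 0 * X 2) := by
  have h2 : (2 : MvPolynomial (Fin 4) (ZMod 2)) = 0 := CharTwo.two_eq_zero
  simp only [map_add, map_mul, map_pow, aeval_X, Matrix.cons_val_zero, Matrix.cons_val_one, Matrix.cons_val_two,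
    Matrix.tail_cons, Matrix.head_cons]
  linear_combination (X 1 * X 3 * X 2 ^ 2 + X 3 ^ 2 * X 2 ^ 2) * h2

/-- The `t`-axis `C = {x₂ = u₂ = w = 0}` of the chart lies in `Sing(E[t]′)`: `g′ = u₂² + x₂w ∈ I(C)² = (x₂, u₂, w)²`
(so `C`, and every closed point of it, is an `E[t]′`-permissible centre). [folklore] -/
theorem W1_strict_mem_sq :
    (X 1 ^ 2 + X 0 * X 2 : MvPolynomial (Fin 4) (ZMod 2)) ∈
      Ideal.span {(X 0 : MvPolynomial (Fin 4) (ZMod 2)), X 1, X 2} ^ 2 := by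
  have h0 : (X 0 : MvPolynomial (Fin 4) (ZMod 2)) ∈
      Ideal.span {(X 0 : MvPolynomial (Fin 4) (ZMod 2)), X 1, X 2} := Ideal.subset_span (by simp)
  have h1 : (X 1 : MvPolynomial (Fin 4) (ZMod 2)) ∈
      Ideal.span {(X 0 : MvPolynomial (Fin 4) (ZMod 2)), X 1, X 2} := Ideal.subset_span (by simp)
  have h2 : (X 2 : MvPolynomial (Fin 4) (ZMod 2)) ∈
      Ideal.span {(X 0 : MvPolynomial (Fin 4) (ZMod 2)), X 1, X 2} := Ideal.subset_span (by simp)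
  rw [pow_two]
  exact add_mem (by rw [pow_two]; exact Ideal.mul_mem_mul h1 h1) (Ideal.mul_mem_mul h0 h2)

/-- Non-vacuity / consistency: `g` passes its own chart test, `φ(g) ∈ (w²)·(x₂, u₂, w)²`. [folklore] -/
theorem W1_chart_g_mem :
    aeval ![(X 0 * X 2 + X 3 ^ 2 : MvPolynomial (Fin 4) (ZMod 2)), (X 1 + X 3) * X 2, X 2]
        (X 1 ^ 2 + X 0 * X 2 ^ 2 : MvPolynomial (Fin 3) (ZMod 2)) ∈
      Ideal.span {(X 2 : MvPolynomial (Fin 4) (ZMod 2)) ^ 2} *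
        Ideal.span {(X 0 : MvPolynomial (Fin 4) (ZMod 2)), X 1, X 2} ^ 2 := by
  rw [W1_chart_g]
  exact Ideal.mul_mem_mul (Ideal.subset_span rfl) W1_strict_mem_sq

/-- Restricting the chart to the `t`-axis direction: killing `x₂, u₂` after `φ` is the monomial substitution
`φ₀ : x ↦ t², y ↦ tw, w ↦ w`. [folklore] -/
theorem W1_proj_chart (f : MvPolynomial (Fin 3) (ZMod 2)) :
    aeval ![(0 : MvPolynomial (Fin 4) (ZMod 2)), 0, X 2, X 3]
        (aeval ![(X 0 * X 2 + X 3 ^ 2 : MvPolynomial (Fin 4) (ZMod 2)), (X 1 + X 3) * X 2, X 2] f) =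
      aeval ![(X 3 ^ 2 : MvPolynomial (Fin 4) (ZMod 2)), X 3 * X 2, X 2] f := by
  have h : (aeval ![(0 : MvPolynomial (Fin 4) (ZMod 2)), 0, X 2, X 3]).comp
      (aeval ![(X 0 * X 2 + X 3 ^ 2 : MvPolynomial (Fin 4) (ZMod 2)), (X 1 + X 3) * X 2, X 2]) =
      aeval ![(X 3 ^ 2 : MvPolynomial (Fin 4) (ZMod 2)), X 3 * X 2, X 2] := by
    refine MvPolynomial.algHom_ext fun i => ?_
    fin_cases i <;> simp
  exact AlgHom.congr_fun h f

/-- … and it maps the chart ideal `(w²)·(x₂,u₂,w)²` onto `(w⁴)`. [folklore] -/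
theorem W1_proj_ideal :
    Ideal.map (aeval ![(0 : MvPolynomial (Fin 4) (ZMod 2)), 0, X 2, X 3])
        (Ideal.span {(X 2 : MvPolynomial (Fin 4) (ZMod 2)) ^ 2} *
          Ideal.span {(X 0 : MvPolynomial (Fin 4) (ZMod 2)), X 1, X 2} ^ 2) =
      Ideal.span {(X 2 : MvPolynomial (Fin 4) (ZMod 2)) ^ 4} := by
  rw [Ideal.map_mul, Ideal.map_pow, Ideal.map_span, Ideal.map_span, Set.image_singleton, Set.image_insert_eq,
    Set.image_insert_eq, Set.image_singleton]
  simp only [map_pow, aeval_X, Matrix.cons_val_zero, Matrix.cons_val_one, Matrix.cons_val_two, Matrix.tail_cons,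
    Matrix.head_cons, Ideal.span_insert_zero, Ideal.span_singleton_pow, Ideal.span_singleton_mul_span_singleton]
  ring_nf

/-- The monomial substitution on monomials: `φ₀(xⁱyʲwᵏ) = wʲ⁺ᵏ t²ⁱ⁺ʲ`. [folklore] -/
theorem W1_spec_monomial (α : Fin 3 →₀ ℕ) (c : ZMod 2) :
    aeval ![(X 3 ^ 2 : MvPolynomial (Fin 4) (ZMod 2)), X 3 * X 2, X 2] (monomial α c) =
      monomial (Finsupp.single 2 (α 1 + α 2) + Finsupp.single 3 (2 * α 0 + α 1)) c := by
  rw [aeval_monomial, Finsupp.prod_fintype _ _ (fun i => by simp), Fin.prod_univ_three]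
  simp only [Matrix.cons_val_zero, Matrix.cons_val_one, Matrix.cons_val_two, Matrix.tail_cons, Matrix.head_cons,
    algebraMap_eq]
  rw [show C c * ((X 3 ^ 2) ^ α 0 * (X 3 * X 2) ^ α 1 * X 2 ^ α 2) =
      C c * ((X 2 : MvPolynomial (Fin 4) (ZMod 2)) ^ (α 1 + α 2) * X 3 ^ (2 * α 0 + α 1)) by ring,
    X_pow_eq_monomial, X_pow_eq_monomial, monomial_mul, C_mul_monomial]
  simp

/-- **The `t`-parity separation.** On BOX exponents (`α_i ≤ 1`) the exponent map `(i,j,k) ↦ (w : j+k, t : 2i+j)` has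
singleton fibres: `wʲ⁺ᵏt²ⁱ⁺ʲ = wᵇ¹⁺ᵇ²t²ᵇ⁰⁺ᵇ¹` forces `β = α` (the parity of the `t`-exponent is `j`). E.g. the `xyw`
coefficient of `f` is the `w²t³` coefficient of `f(t², tw, w)`. [folklore] -/
theorem W1_specMap_fiber (α β : Fin 3 →₀ ℕ) (hα : ∀ i, α i ≤ 1)
    (h : Finsupp.single (2 : Fin 4) (β 1 + β 2) + Finsupp.single 3 (2 * β 0 + β 1) =
      Finsupp.single (2 : Fin 4) (α 1 + α 2) + Finsupp.single 3 (2 * α 0 + α 1)) : β = α := by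
  have h2 := DFunLike.congr_fun h 2
  have h3 := DFunLike.congr_fun h 3
  simp at h2 h3
  have a0 := hα 0
  have a1 := hα 1
  have a2 := hα 2
  ext i; fin_cases i <;> simp <;> omega

/-- **Coefficient transport** (box exponents): the coefficient of `xⁱyʲwᵏ` (`i,j,k ≤ 1`) in `f` equals the
coefficient of `wʲ⁺ᵏt²ⁱ⁺ʲ` in `φ₀(f) = f(t², tw, w)`. [folklore] -/
theorem W1_coeff_transport (f : MvPolynomial (Fin 3) (ZMod 2)) (α : Fin 3 →₀ ℕ) (hα : ∀ i, α i ≤ 1) :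
    coeff (Finsupp.single 2 (α 1 + α 2) + Finsupp.single 3 (2 * α 0 + α 1))
        (aeval ![(X 3 ^ 2 : MvPolynomial (Fin 4) (ZMod 2)), X 3 * X 2, X 2] f) = coeff α f := by
  classical
  induction f using MvPolynomial.induction_on' with
  | monomial β c =>
    rw [W1_spec_monomial, coeff_monomial, coeff_monomial]
    by_cases hβ : β = α
    · subst hβ; simp
    · rw [if_neg hβ, if_neg fun h => hβ (W1_specMap_fiber α β hα h)]
  | add p q hp hq => rw [map_add, coeff_add, coeff_add, hp, hq]

/-- **(LSB) forces all eight box coefficients (`xᵃyᵇwᶜ`, `a,b,c ≤ 1`, including `xyw`) of every `f ∈ ℘(E,2)` to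
vanish: `P 2 ⊆ 𝔪_ξ^{[2]} = (x², y², w²)`.** Hypothesis (LSB): for `f ∈ P 2`, `φ(f) ∈ (w²)·(x₂,u₂,w)²` — the transform
`(f′,2)` of `((f),2)[t]` under the blow-up of `Z[t]` along `D_t` exists on the `w`-chart (`w² ∣ φ f`) and has order
`≥ 2` along the `t`-axis `C ⊂ Sing(E[t]′)`. Proof: kill `x₂, u₂`; then `f(t², tw, w) ∈ (w⁴)`, and the box
coefficients of `f` are coefficients of monomials `wᵃtᵇ` with `a ≤ 2 < 4`. [folklore] -/
theorem W1_P2_le_span_sq (P : ℕ → Ideal (MvPolynomial (Fin 3) (ZMod 2)))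
    (hLSB : ∀ f ∈ P 2,
      aeval ![(X 0 * X 2 + X 3 ^ 2 : MvPolynomial (Fin 4) (ZMod 2)), (X 1 + X 3) * X 2, X 2] f ∈
        Ideal.span {(X 2 : MvPolynomial (Fin 4) (ZMod 2)) ^ 2} *
          Ideal.span {(X 0 : MvPolynomial (Fin 4) (ZMod 2)), X 1, X 2} ^ 2) :
    P 2 ≤ Ideal.span (Set.range fun i : Fin 3 => (X i : MvPolynomial (Fin 3) (ZMod 2)) ^ 2) := by
  intro f hf
  have hF := Ideal.mem_map_of_mem (aeval ![(0 : MvPolynomial (Fin 4) (ZMod 2)), 0, X 2, X 3]) (hLSB f hf)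
  rw [W1_proj_ideal, W1_proj_chart] at hF
  have hF' : aeval ![(X 3 ^ 2 : MvPolynomial (Fin 4) (ZMod 2)), X 3 * X 2, X 2] f ∈
      Ideal.span ((fun s : Fin 4 →₀ ℕ => monomial s (1 : ZMod 2)) '' {Finsupp.single 2 4}) := by
    rwa [Set.image_singleton, ← X_pow_eq_monomial]
  rw [mem_ideal_span_monomial_image] at hF'
  refine mem_span_sq_of_support f fun α hα => ?_
  by_contra hne
  have hα1 : ∀ i, α i ≤ 1 := fun i => Nat.lt_succ_iff.mp (lt_of_not_ge fun h => hne ⟨i, h⟩)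
  have hmem : Finsupp.single (2 : Fin 4) (α 1 + α 2) + Finsupp.single 3 (2 * α 0 + α 1) ∈
      (aeval ![(X 3 ^ 2 : MvPolynomial (Fin 4) (ZMod 2)), X 3 * X 2, X 2] f).support := by
    rw [mem_support_iff, W1_coeff_transport f α hα1]
    exact mem_support_iff.mp hα
  obtain ⟨_, rfl, hle⟩ := hF' _ hmem
  rw [Finsupp.single_le_iff] at hle
  simp at hle
  have a1 := hα1 1
  have a2 := hα1 2
  omega

/-- **ALIVE-type certificate shape for `W1`.** Under (ORD) and (LSB): `sandwichPNega 2 1 P 2 a ⊆ 𝔪_ξ^{[2]} ⊆ 𝔪_ξ` for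
EVERY `a : ℕ`, and `Campaign.SandwichNegaNoUnit 2 1 P 2` (`1 ∉ ℘nega_sandwich(W1,−a)` for all `a > 0`). The same
statement, verbatim, covers the `x`-chart transform `E′ = ((y₁² + xw₁²), 2)` at `ξ′` (the same polynomial).
[folklore] -/
theorem W1_sandwichNegaNoUnit (P : ℕ → Ideal (MvPolynomial (Fin 3) (ZMod 2)))
    (hord : ∀ j : ℕ, P j ≤ idealOfVars (Fin 3) (ZMod 2) ^ j)
    (hLSB : ∀ f ∈ P 2,
      aeval ![(X 0 * X 2 + X 3 ^ 2 : MvPolynomial (Fin 4) (ZMod 2)), (X 1 + X 3) * X 2, X 2] f ∈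
        Ideal.span {(X 2 : MvPolynomial (Fin 4) (ZMod 2)) ^ 2} *
          Ideal.span {(X 0 : MvPolynomial (Fin 4) (ZMod 2)), X 1, X 2} ^ 2) :
    (∀ a : ℕ, sandwichPNega 2 1 P 2 a ≤ idealOfVars (Fin 3) (ZMod 2)) ∧ SandwichNegaNoUnit 2 1 P 2 := by
  refine sandwichNegaNoUnit_of_multiples 2 1 range_X_sq_subset_range_frobenius span_sq_le_idealOfVars
    idealOfVars_ne_top fun n hn => ?_
  rcases Nat.lt_or_ge n 2 with h | h
  · obtain rfl : n = 1 := by omega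
    simpa using W1_P2_le_span_sq P hLSB
  · exact (hord _).trans ((Ideal.pow_le_pow_right (by omega)).trans pow_four_idealOfVars_le_span_sq)

/-- Non-vacuity: SOME family with `g ∈ P 2` satisfies (ORD) and (LSB) — namely `P j = if j = 2 then (g) else 0`.
[folklore] -/
theorem W1_hypotheses_nonvacuous :
    ∃ P : ℕ → Ideal (MvPolynomial (Fin 3) (ZMod 2)),
      (X 1 ^ 2 + X 0 * X 2 ^ 2 : MvPolynomial (Fin 3) (ZMod 2)) ∈ P 2 ∧
      (∀ j : ℕ, P j ≤ idealOfVars (Fin 3) (ZMod 2) ^ j) ∧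
      (∀ f ∈ P 2,
        aeval ![(X 0 * X 2 + X 3 ^ 2 : MvPolynomial (Fin 4) (ZMod 2)), (X 1 + X 3) * X 2, X 2] f ∈
          Ideal.span {(X 2 : MvPolynomial (Fin 4) (ZMod 2)) ^ 2} *
            Ideal.span {(X 0 : MvPolynomial (Fin 4) (ZMod 2)), X 1, X 2} ^ 2) := by
  refine ⟨fun j => if j = 2 then Ideal.span {(X 1 ^ 2 + X 0 * X 2 ^ 2 : MvPolynomial (Fin 3) (ZMod 2))} else ⊥,
    ?_, fun j => ?_, fun f hf => ?_⟩
  · simp only [↓reduceIte]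
    exact Ideal.mem_span_singleton_self _
  · by_cases hj : j = 2
    · subst hj
      simp only [↓reduceIte]
      exact (Ideal.span_singleton_le_iff_mem _).mpr W1_g_mem_sq
    · simp [hj]
  · simp only [↓reduceIte] at hf
    obtain ⟨c, rfl⟩ := Ideal.mem_span_singleton'.mp hf
    rw [map_mul]
    exact Ideal.mul_mem_left _ _ W1_chart_g_mem

end W1



/-! ## Degrees `a` beyond the first window: only the multiples `℘(E, n·m)` with `n·m ≥ a` enter -/

section Window

universe v

variable {O : Type v} [CommRing O] (p : ℕ) [Fact p.Prime] [CharP O p]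

/-- **Windowed no-unit direction.** `sandwichPNega p e P m a ⊆ Q = span S` (`S ⊆ ρ^e(O)`) as soon as `℘(E, n·m) ⊆ Q`
for those `n ≥ 1` with `a ≤ n·m` — the only summands `D(m,a,d)` of Eq. (36) that occur in degree `−a`. [folklore] -/
theorem sandwichPNega_le_span_of_window (e : ℕ) {S : Set O} (hS : S ⊆ Set.range (iterateFrobenius O p e))
    {P : ℕ → Ideal O} {m : ℕ} (a : ℕ) (hP : ∀ n : ℕ, 0 < n → a ≤ n * m → P (n * m) ≤ Ideal.span S) :
    sandwichPNega p e P m a ≤ Ideal.span S := by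
  unfold sandwichPNega S05NegativePart.pNega S05NegativePart.pTildeNeg
  refine iSup₂_le fun d hd => ?_
  unfold S05NegativePart.DD
  refine W12.diffIdeal_le_span e _ hS ?_
  unfold S05NegativePart.pPosi
  split_ifs with h
  · exact bot_le
  · have hd0 : 0 ≤ d := by
      by_contra hneg
      apply h
      exact Int.toNat_eq_zero.mpr (Int.mul_nonpos_of_nonpos_of_nonneg (le_of_not_ge hneg) (by positivity))
    obtain ⟨n, rfl⟩ := Int.eq_ofNat_of_zero_le hd0
    have hcast : ((n : ℤ) * (m : ℤ)).toNat = n * m := by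
      rw [show ((n : ℤ) * (m : ℤ)) = ((n * m : ℕ) : ℤ) by push_cast; ring, Int.toNat_natCast]
    rw [hcast] at h ⊢
    have han : a ≤ n * m := by
      rw [Nat.abs_cast] at hd
      exact_mod_cast hd
    refine hP n (Nat.pos_of_ne_zero ?_) han
    rintro rfl
    exact h (by simp)

end Window

/-- **`W2`, degrees `a ≥ 3`: `℘nega_sandwich(W2,−a) ⊆ 𝔪_ξ^{[2]} ⊆ 𝔪_ξ`** under (ORD) alone — for `a ≥ 3` every summand has
`d ≥ 2`, and `℘(E,2d) ⊆ 𝔪_ξ⁴ ⊆ 𝔪_ξ^{[2]}` (three variables). Together with part 1 (`W2_not_sandwichPNega_le`, degrees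
`−1, −2` NOT in `𝔪_ξ`) this computes the degree set `{a : ℘nega_sandwich(W2,−a) ⊄ 𝔪_ξ} = {1, 2}` for every family `P`
with `g ∈ P 2` and (ORD) (`O = 𝔽₂[y, ω₁, ω₂]`). [folklore] -/
theorem W2_sandwichPNega_le_of_three_le (P : ℕ → Ideal (MvPolynomial (Fin 3) (ZMod 2)))
    (hord : ∀ j : ℕ, P j ≤ idealOfVars (Fin 3) (ZMod 2) ^ j) (a : ℕ) (ha : 3 ≤ a) :
    sandwichPNega 2 1 P 2 a ≤ Ideal.span (Set.range fun i : Fin 3 => (X i : MvPolynomial (Fin 3) (ZMod 2)) ^ 2) ∧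
      sandwichPNega 2 1 P 2 a ≤ idealOfVars (Fin 3) (ZMod 2) := by
  have h : sandwichPNega 2 1 P 2 a ≤
      Ideal.span (Set.range fun i : Fin 3 => (X i : MvPolynomial (Fin 3) (ZMod 2)) ^ 2) :=
    sandwichPNega_le_span_of_window 2 1 range_X_sq_subset_range_frobenius a fun n _ hn =>
      (hord _).trans ((Ideal.pow_le_pow_right (by omega)).trans pow_four_idealOfVars_le_span_sq)
  exact ⟨h, h.trans span_sq_le_idealOfVars⟩

end Summit.ResolutionOfSingularities.ResolutionOfSingularities.Theorems.Campaign.K11Repro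

end
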